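import Literature.NumberTheory.EllipticCurves.LevelStructureTransport
import Literature.NumberTheory.EllipticCurves.ModularFunctionFieldUniformizers
import Literature.NumberTheory.EllipticCurves.UniformizationProofs
import HarnessLib

/-!
# The Eisenstein coordinates `E₄, E₆, E₄(Nτ), E₆(Nτ)` separate the points of `Y₀(N)`

Topic `NumberTheory/EllipticCurves` (moduli of level `Γ₀(N)`; first file of the "canonical model of
`X₀(N)` at CM points" chain serving `heegnerPointComplex_mem_range_map`).  The four modular forms
`E₄, E₆ ∈ M_*(SL₂(ℤ))` and `E₄(Nτ), E₆(Nτ) ∈ M_*(Γ₀(N))` (the tree's `scaleN`) are, up to the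
constants `4π⁴/3`, `8π⁶/27`, the Weierstrass invariants `g₂, g₃` of the two lattices
`Λ_τ = ℤτ + ℤ` and `Λ_{Nτ} = ℤNτ + ℤ` whose common homothety class is the point `Γ₀(N)τ ∈ Y₀(N)`
(`LevelStructureTransport.lean`: `exists_gamma0_smul_eq_of_lattice_pair_eq`).  Consequently the
point of the weighted projective space `P(4, 6, 4, 6)` with these coordinates determines `Γ₀(N)τ`,
i.e. **six weight-zero ratios `m/Δ`, `m` a monomial of weight `12` in the four forms, separate
the points of `Y₀(N)`**, and their values at `τ` are transported along any automorphism
`σ` of `ℂ` exactly as the level-`N` structure of `τ` is (`LevelTransport`), because in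
`m/Δ = (rational) · (monomial in g₂, g₃)/(g₂³ − 27g₃²)` the powers of `π` cancel.

* `exists_common_scaling` — the algebra of `P(4, 6, 4, 6)`: if the weight-`12` monomials of two
  quadruples `(g₂, g₃, h₂, h₃)`, `(g₂', g₃', h₂', h₃')` are proportional (and `g₂³ ≠ 27g₃²`), there is
  `ν ≠ 0` with `(g₂', g₃', h₂', h₃') = (ν⁴g₂, ν⁶g₃, ν⁴h₂, ν⁶h₃)` (no roots of unity: `ν² = g₃'g₂/(g₃g₂')`).
* `eisMonomial N i` (`i : Fin 6`) — the monomials `E₄³, E₆², E₄²E₄(Nτ), E₆E₆(Nτ), E₄(Nτ)³,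
  E₆(Nτ)²` as forms of weight `12`; `eisCoord N i τ = m_i(τ)/Δ(τ)`; `eisCoordFn N i = m_i/Δ ∈ K_N`
  (`mkFn`); `eisCoord_eq` — the coordinates as `1728·` resp. `46656·`(monomial in the lattice
  invariants)`/(g₂³ − 27g₃²)`.
* `exists_gamma0_smul_eq_of_eisCoord_eq`, `eisCoord_eq_iff` — **injectivity**: equal coordinates ⇔
  same point of `Y₀(N)`; `eisCoord_gamma0_smul` — `Γ₀(N)`-invariance.
* `LevelTransport.apply_eisCoord` — **transport**: `LevelTransport N σ τ τ' ⇒ σ(eisCoord i τ) =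
  eisCoord i τ'`.
* `pointPlace_ne_of_eisCoord_ne`, `pointPlace_eq_iff` — **`P_{τ₁} = P_{τ₂}` iff `τ₂ ∈ Γ₀(N)τ₁`**:
  distinct points of `Y₀(N)` have distinct places of `K_N` (the functions `m_i/Δ − cᵢ` detect them),
  completing the tree's `pointPlace_smul_of_mem` (Diamond–Shurman §7.5: the points of the compact
  Riemann surface are places of its function field).

Everything is proved; the definitions are the coordinate functions only (no named facts).

## References

* F. Diamond, J. Shurman, *A First Course in Modular Forms*, GTM 228, Springer 2005, §1.5
  (Thm. 1.5.1), §7.5. [DiamondShurman2005]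
* G. Shimura, *Introduction to the arithmetic theory of automorphic functions*, 1971, §2.4, §4.2,
  §6.7. [ShimuraIATAF1971]
* J.-P. Serre, *A Course in Arithmetic*, GTM 7, 1973, VII §4.1 (`g₂ = (4π⁴/3)E₄`,
  `g₃ = (8π⁶/27)E₆`). [Serre1973]
-/

noncomputable section

open Complex UpperHalfPlane CongruenceSubgroup PeriodPair ModularForm EisensteinSeries
open scoped MatrixGroups Real

namespace Literature.NumberTheory.EllipticCurves

open Literature.NumberTheory.EllipticCurves.ModularForms

/-! ### The algebra of the weighted projective space `P(4, 6, 4, 6)` -/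

/-- A square root `ν` of `b/a` has `ν⁴ = a` and `ν⁶ = b` as soon as `a³ = b²` (`a ≠ 0`); this is
how a common scaling is extracted from proportional weight-`12` monomials without any bookkeeping
of roots of unity. [folklore] -/
theorem exists_pow_four_eq_pow_six_eq {a b : ℂ} (ha : a ≠ 0) (hab : a ^ 3 = b ^ 2) :
    ∃ ν : ℂ, ν ≠ 0 ∧ ν ^ 4 = a ∧ ν ^ 6 = b := by
  have hb : b ≠ 0 := by
    intro hb; apply ha
    have : a ^ 3 = 0 := by rw [hab, hb]; ring
    exact pow_eq_zero_iff (n := 3) (by norm_num) |>.mp this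
  obtain ⟨ν, hν⟩ := IsAlgClosed.exists_pow_nat_eq (b / a) two_pos
  have hν0 : ν ≠ 0 := by
    intro h; rw [h, zero_pow two_ne_zero] at hν
    exact div_ne_zero hb ha hν.symm
  refine ⟨ν, hν0, ?_, ?_⟩
  · rw [show ν ^ 4 = (ν ^ 2) ^ 2 by ring, hν, div_pow, ← hab]
    field_simp
  · rw [show ν ^ 6 = (ν ^ 2) ^ 3 by ring, hν, div_pow, hab]
    field_simp

/-- **Proportional weight-`12` monomials come from a common scaling.**  Let `(g₂, g₃, h₂, h₃)` and
`(g₂', g₃', h₂', h₃')` be two quadruples of "weights" `(4, 6, 4, 6)` with `g₂³ − 27g₃² ≠ 0`, and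
suppose the six monomials `g₂³, g₃², g₂²h₂, g₃h₃, h₂³, h₃²` of weight `12` of the second are `λ` times
those of the first, `λ ≠ 0`.  Then `(g₂', g₃', h₂', h₃') = (ν⁴g₂, ν⁶g₃, ν⁴h₂, ν⁶h₃)` for some `ν ≠ 0`
— the two quadruples are the same point of `P(4, 6, 4, 6)`. [folklore] -/
theorem exists_common_scaling {g₂ g₃ h₂ h₃ g₂' g₃' h₂' h₃' lam : ℂ} (hD : g₂ ^ 3 - 27 * g₃ ^ 2 ≠ 0)
    (hlam : lam ≠ 0) (e1 : g₂' ^ 3 = lam * g₂ ^ 3) (e2 : g₃' ^ 2 = lam * g₃ ^ 2)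
    (e3 : g₂' ^ 2 * h₂' = lam * (g₂ ^ 2 * h₂)) (e4 : g₃' * h₃' = lam * (g₃ * h₃))
    (e5 : h₂' ^ 3 = lam * h₂ ^ 3) (e6 : h₃' ^ 2 = lam * h₃ ^ 2) :
    ∃ ν : ℂ, ν ≠ 0 ∧ g₂' = ν ^ 4 * g₂ ∧ g₃' = ν ^ 6 * g₃ ∧ h₂' = ν ^ 4 * h₂ ∧ h₃' = ν ^ 6 * h₃ := by
  -- `x' = 0 ↔ x = 0` for each coordinate
  have hg₂ : g₂' = 0 ↔ g₂ = 0 := by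
    constructor
    · intro h; rw [h, zero_pow three_ne_zero, eq_comm, mul_eq_zero] at e1
      exact (pow_eq_zero_iff three_ne_zero).mp (e1.resolve_left hlam)
    · intro h; rw [h, zero_pow three_ne_zero, mul_zero] at e1
      exact (pow_eq_zero_iff three_ne_zero).mp e1
  have hg₃ : g₃' = 0 ↔ g₃ = 0 := by
    constructor
    · intro h; rw [h, zero_pow two_ne_zero, eq_comm, mul_eq_zero] at e2
      exact (pow_eq_zero_iff two_ne_zero).mp (e2.resolve_left hlam)
    · intro h; rw [h, zero_pow two_ne_zero, mul_zero] at e2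
      exact (pow_eq_zero_iff two_ne_zero).mp e2
  have hh₂ : h₂' = 0 ↔ h₂ = 0 := by
    constructor
    · intro h; rw [h, zero_pow three_ne_zero, eq_comm, mul_eq_zero] at e5
      exact (pow_eq_zero_iff three_ne_zero).mp (e5.resolve_left hlam)
    · intro h; rw [h, zero_pow three_ne_zero, mul_zero] at e5
      exact (pow_eq_zero_iff three_ne_zero).mp e5
  have hh₃ : h₃' = 0 ↔ h₃ = 0 := by
    constructor
    · intro h; rw [h, zero_pow two_ne_zero, eq_comm, mul_eq_zero] at e6
      exact (pow_eq_zero_iff two_ne_zero).mp (e6.resolve_left hlam)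
    · intro h; rw [h, zero_pow two_ne_zero, mul_zero] at e6
      exact (pow_eq_zero_iff two_ne_zero).mp e6
  by_cases hg2 : g₂ = 0
  · -- `g₂ = 0`: then `g₃ ≠ 0`; scale read off `g₃` and `h₂` (or a sixth root if `h₂ = 0`)
    have hg3 : g₃ ≠ 0 := by
      intro h; apply hD; rw [hg2, h]; ring
    have hg2' : g₂' = 0 := hg₂.mpr hg2
    have hg3' : g₃' ≠ 0 := fun h ↦ hg3 (hg₃.mp h)
    by_cases hh2 : h₂ = 0
    · have hh2' : h₂' = 0 := hh₂.mpr hh2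
      obtain ⟨ν, hν⟩ := IsAlgClosed.exists_pow_nat_eq (g₃' / g₃) (by norm_num : 0 < 6)
      have hν0 : ν ≠ 0 := by
        intro h; rw [h, zero_pow (by norm_num)] at hν
        exact div_ne_zero hg3' hg3 hν.symm
      have hlam' : lam = ν ^ 12 := by
        have : g₃' = ν ^ 6 * g₃ := by rw [show ν ^ 6 = g₃' / g₃ from hν]; field_simp
        rw [this] at e2
        have e2' : (ν ^ 12 - lam) * g₃ ^ 2 = 0 := by linear_combination e2
        rcases mul_eq_zero.mp e2' with h | h
        · linear_combination -h
        · exact absurd ((pow_eq_zero_iff two_ne_zero).mp h) hg3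
      refine ⟨ν, hν0, by rw [hg2, hg2', mul_zero], ?_, by rw [hh2, hh2', mul_zero], ?_⟩
      · rw [show ν ^ 6 = g₃' / g₃ from hν]; field_simp
      · have h6 : ν ^ 6 = g₃' / g₃ := hν
        have : g₃' = ν ^ 6 * g₃ := by rw [h6]; field_simp
        rw [this, hlam'] at e4
        have e4' : ν ^ 6 * g₃ * (h₃' - ν ^ 6 * h₃) = 0 := by linear_combination e4
        rcases mul_eq_zero.mp e4' with h | h
        · rcases mul_eq_zero.mp h with h' | h'
          · exact absurd ((pow_eq_zero_iff (by norm_num)).mp h') hν0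
          · exact absurd h' hg3
        · linear_combination h
    · have hh2' : h₂' ≠ 0 := fun h ↦ hh2 (hh₂.mp h)
      -- `a = h₂'/h₂`, `b = g₃'/g₃`, `a³ = λ = b²`
      obtain ⟨ν, hν0, hν4, hν6⟩ := exists_pow_four_eq_pow_six_eq (a := h₂' / h₂) (b := g₃' / g₃)
        (div_ne_zero hh2' hh2) (by
          rw [div_pow, div_pow, div_eq_div_iff (pow_ne_zero _ hh2) (pow_ne_zero _ hg3)]
          linear_combination g₃ ^ 2 * e5 - h₂ ^ 3 * e2)
      have hlam' : lam = ν ^ 12 := by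
        have : h₂' = ν ^ 4 * h₂ := by rw [hν4]; field_simp
        rw [this] at e5
        have e5' : (ν ^ 12 - lam) * h₂ ^ 3 = 0 := by linear_combination e5
        rcases mul_eq_zero.mp e5' with h | h
        · linear_combination -h
        · exact absurd ((pow_eq_zero_iff three_ne_zero).mp h) hh2
      refine ⟨ν, hν0, by rw [hg2, hg2', mul_zero], by rw [hν6]; field_simp,
        by rw [hν4]; field_simp, ?_⟩
      have : g₃' = ν ^ 6 * g₃ := by rw [hν6]; field_simp
      rw [this, hlam'] at e4
      have e4' : ν ^ 6 * g₃ * (h₃' - ν ^ 6 * h₃) = 0 := by linear_combination e4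
      rcases mul_eq_zero.mp e4' with h | h
      · rcases mul_eq_zero.mp h with h' | h'
        · exact absurd ((pow_eq_zero_iff (by norm_num)).mp h') hν0
        · exact absurd h' hg3
      · linear_combination h
  · by_cases hg3 : g₃ = 0
    · -- `g₃ = 0`, `g₂ ≠ 0`: scale read off `g₂` and `h₃` (or a fourth root if `h₃ = 0`)
      have hg3' : g₃' = 0 := hg₃.mpr hg3
      have hg2' : g₂' ≠ 0 := fun h ↦ hg2 (hg₂.mp h)
      by_cases hh3 : h₃ = 0
      · have hh3' : h₃' = 0 := hh₃.mpr hh3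
        obtain ⟨ν, hν⟩ := IsAlgClosed.exists_pow_nat_eq (g₂' / g₂) (by norm_num : 0 < 4)
        have hν0 : ν ≠ 0 := by
          intro h; rw [h, zero_pow (by norm_num)] at hν
          exact div_ne_zero hg2' hg2 hν.symm
        have hg₂eq : g₂' = ν ^ 4 * g₂ := by rw [show ν ^ 4 = g₂' / g₂ from hν]; field_simp
        have hlam' : lam = ν ^ 12 := by
          rw [hg₂eq] at e1
          have e1' : (ν ^ 12 - lam) * g₂ ^ 3 = 0 := by linear_combination e1
          rcases mul_eq_zero.mp e1' with h | h
          · linear_combination -h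
          · exact absurd ((pow_eq_zero_iff three_ne_zero).mp h) hg2
        refine ⟨ν, hν0, hg₂eq, by rw [hg3, hg3', mul_zero], ?_, by rw [hh3, hh3', mul_zero]⟩
        rw [hg₂eq, hlam'] at e3
        have e3' : ν ^ 8 * g₂ ^ 2 * (h₂' - ν ^ 4 * h₂) = 0 := by linear_combination e3
        rcases mul_eq_zero.mp e3' with h | h
        · rcases mul_eq_zero.mp h with h' | h'
          · exact absurd ((pow_eq_zero_iff (by norm_num)).mp h') hν0
          · exact absurd ((pow_eq_zero_iff two_ne_zero).mp h') hg2
        · linear_combination h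
      · have hh3' : h₃' ≠ 0 := fun h ↦ hh3 (hh₃.mp h)
        obtain ⟨ν, hν0, hν4, hν6⟩ := exists_pow_four_eq_pow_six_eq (a := g₂' / g₂) (b := h₃' / h₃)
          (div_ne_zero hg2' hg2) (by
            rw [div_pow, div_pow, div_eq_div_iff (pow_ne_zero _ hg2) (pow_ne_zero _ hh3)]
            linear_combination h₃ ^ 2 * e1 - g₂ ^ 3 * e6)
        have hg₂eq : g₂' = ν ^ 4 * g₂ := by rw [hν4]; field_simp
        have hlam' : lam = ν ^ 12 := by
          rw [hg₂eq] at e1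
          have e1' : (ν ^ 12 - lam) * g₂ ^ 3 = 0 := by linear_combination e1
          rcases mul_eq_zero.mp e1' with h | h
          · linear_combination -h
          · exact absurd ((pow_eq_zero_iff three_ne_zero).mp h) hg2
        refine ⟨ν, hν0, hg₂eq, by rw [hg3, hg3', mul_zero], ?_, by rw [hν6]; field_simp⟩
        rw [hg₂eq, hlam'] at e3
        have e3' : ν ^ 8 * g₂ ^ 2 * (h₂' - ν ^ 4 * h₂) = 0 := by linear_combination e3
        rcases mul_eq_zero.mp e3' with h | h
        · rcases mul_eq_zero.mp h with h' | h'
          · exact absurd ((pow_eq_zero_iff (by norm_num)).mp h') hν0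
          · exact absurd ((pow_eq_zero_iff two_ne_zero).mp h') hg2
        · linear_combination h
    · -- generic case: `ν² = (g₃'/g₃)/(g₂'/g₂)`
      have hg2' : g₂' ≠ 0 := fun h ↦ hg2 (hg₂.mp h)
      have hg3' : g₃' ≠ 0 := fun h ↦ hg3 (hg₃.mp h)
      obtain ⟨ν, hν0, hν4, hν6⟩ := exists_pow_four_eq_pow_six_eq (a := g₂' / g₂) (b := g₃' / g₃)
        (div_ne_zero hg2' hg2) (by
          rw [div_pow, div_pow, div_eq_div_iff (pow_ne_zero _ hg2) (pow_ne_zero _ hg3)]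
          linear_combination g₃ ^ 2 * e1 - g₂ ^ 3 * e2)
      have hg₂eq : g₂' = ν ^ 4 * g₂ := by rw [hν4]; field_simp
      have hg₃eq : g₃' = ν ^ 6 * g₃ := by rw [hν6]; field_simp
      have hlam' : lam = ν ^ 12 := by
        rw [hg₂eq] at e1
        have e1' : (ν ^ 12 - lam) * g₂ ^ 3 = 0 := by linear_combination e1
        rcases mul_eq_zero.mp e1' with h | h
        · linear_combination -h
        · exact absurd ((pow_eq_zero_iff three_ne_zero).mp h) hg2
      refine ⟨ν, hν0, hg₂eq, hg₃eq, ?_, ?_⟩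
      · rw [hg₂eq, hlam'] at e3
        have e3' : ν ^ 8 * g₂ ^ 2 * (h₂' - ν ^ 4 * h₂) = 0 := by linear_combination e3
        rcases mul_eq_zero.mp e3' with h | h
        · rcases mul_eq_zero.mp h with h' | h'
          · exact absurd ((pow_eq_zero_iff (by norm_num)).mp h') hν0
          · exact absurd ((pow_eq_zero_iff two_ne_zero).mp h') hg2
        · linear_combination h
      · rw [hg₃eq, hlam'] at e4
        have e4' : ν ^ 6 * g₃ * (h₃' - ν ^ 6 * h₃) = 0 := by linear_combination e4
        rcases mul_eq_zero.mp e4' with h | h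
        · rcases mul_eq_zero.mp h with h' | h'
          · exact absurd ((pow_eq_zero_iff (by norm_num)).mp h') hν0
          · exact absurd h' hg3
        · linear_combination h

/-! ### The four forms and the two lattices -/

section Forms

variable (N : ℕ) [NeZero N]

/-- `Nτ` as the point `diag(N, 1) · τ` of the tree (`tpD`). [folklore] -/
theorem levelPoint_eq_tpD_smul (τ : ℍ) : levelPoint N τ = tpD N • τ :=
  UpperHalfPlane.ext (by rw [coe_levelPoint, coe_tpD_smul])

/-- `E₄ = (3/(4π⁴)) g₂(Λ_τ)`, i.e. `g₂(Λ_τ) = (4π⁴/3)E₄(τ)` read backwards. [folklore] -/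
theorem E₄_eq_g₂ (τ : ℍ) : E₄ τ = (ofUpperHalfPlane τ).g₂ / (4 * (π : ℂ) ^ 4 / 3) := by
  rw [g₂_ofUpperHalfPlane]
  have hπ : (π : ℂ) ≠ 0 := by exact_mod_cast Real.pi_ne_zero
  field_simp

/-- `E₆ = (27/(8π⁶)) g₃(Λ_τ)`. [folklore] -/
theorem E₆_eq_g₃ (τ : ℍ) : E₆ τ = (ofUpperHalfPlane τ).g₃ / (8 * (π : ℂ) ^ 6 / 27) := by
  rw [g₃_ofUpperHalfPlane]
  have hπ : (π : ℂ) ≠ 0 := by exact_mod_cast Real.pi_ne_zero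
  field_simp

/-- `E₄(Nτ)` in terms of `g₂(Λ_{Nτ})`. [folklore] -/
theorem scaleN_E₄_eq_g₂ (τ : ℍ) :
    scaleN N E₄ τ = (ofUpperHalfPlane (levelPoint N τ)).g₂ / (4 * (π : ℂ) ^ 4 / 3) := by
  rw [scaleN_apply, ← levelPoint_eq_tpD_smul, E₄_eq_g₂]

/-- `E₆(Nτ)` in terms of `g₃(Λ_{Nτ})`. [folklore] -/
theorem scaleN_E₆_eq_g₃ (τ : ℍ) :
    scaleN N E₆ τ = (ofUpperHalfPlane (levelPoint N τ)).g₃ / (8 * (π : ℂ) ^ 6 / 27) := by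
  rw [scaleN_apply, ← levelPoint_eq_tpD_smul, E₆_eq_g₃]

/-- `Δ(τ) = (g₂³ − 27g₃²)(Λ_τ)/(2π)¹²`. [folklore] -/
theorem discriminant_eq_discr (τ : ℍ) :
    ModularForm.discriminant τ =
      ((ofUpperHalfPlane τ).g₂ ^ 3 - 27 * (ofUpperHalfPlane τ).g₃ ^ 2) / (2 * (π : ℂ)) ^ 12 := by
  rw [discr_ofUpperHalfPlane]
  have hπ : (π : ℂ) ≠ 0 := by exact_mod_cast Real.pi_ne_zero
  field_simp

/-! ### The six weight-`12` monomials and the Eisenstein coordinates -/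

/-- The six monomials of weight `12` in `E₄, E₆, E₄(Nτ), E₆(Nτ)` used as coordinates:
`E₄³, E₆², E₄²E₄(Nτ), E₆E₆(Nτ), E₄(Nτ)³, E₆(Nτ)²`, as modular forms of weight `12` for `Γ₀(N)`.
[folklore] -/
def eisMonomial : Fin 6 → ModularForm (Gamma0 N) 12
  | 0 => ((ofLevelOne (Gamma0 N) E₄).pow 3).mcast (by norm_num)
  | 1 => ((ofLevelOne (Gamma0 N) E₆).pow 2).mcast (by norm_num)
  | 2 => (((ofLevelOne (Gamma0 N) E₄).pow 2).mul (scaleN N E₄)).mcast (by norm_num)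
  | 3 => ((ofLevelOne (Gamma0 N) E₆).mul (scaleN N E₆)).mcast (by norm_num)
  | 4 => ((scaleN N E₄).pow 3).mcast (by norm_num)
  | 5 => ((scaleN N E₆).pow 2).mcast (by norm_num)

/-- The **Eisenstein coordinates** of `τ`: the six numbers `m_i(τ)/Δ(τ)` (`Δ(τ) ≠ 0` on `ℍ`), values
at `τ` of the weight-zero modular functions `m_i/Δ ∈ K_N` (`eisCoordFn`). [folklore] -/
def eisCoord (i : Fin 6) (τ : ℍ) : ℂ :=
  eisMonomial N i τ / ModularForm.discriminant τ

/-- The modular function `m_i/Δ ∈ K_N` whose value at `τ` is `eisCoord N i τ`. [folklore] -/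
def eisCoordFn (i : Fin 6) : modularFunctionField N :=
  mkFn (eisMonomial N i) (deltaN N) ofLevelOne_delta_ne_zero

variable {N}

/-- The values of the six monomials. [folklore] -/
theorem eisMonomial_apply (i : Fin 6) (τ : ℍ) :
    eisMonomial N i τ =
      match i with
      | 0 => E₄ τ ^ 3
      | 1 => E₆ τ ^ 2
      | 2 => E₄ τ ^ 2 * scaleN N E₄ τ
      | 3 => E₆ τ * scaleN N E₆ τ
      | 4 => scaleN N E₄ τ ^ 3
      | 5 => scaleN N E₆ τ ^ 2 := by
  fin_cases i <;> simp [eisMonomial, ModularForm.mcast, ModularForm.pow, coe_ofLevelOne] <;> rfl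

/-- `Δ(τ) ≠ 0`, in the form used for the coordinates. [folklore] -/
theorem discr_div_ne_zero (τ : ℍ) :
    ((ofUpperHalfPlane τ).g₂ ^ 3 - 27 * (ofUpperHalfPlane τ).g₃ ^ 2) ≠ 0 :=
  (ofUpperHalfPlane τ).discr_ne_zero

/-- **The coordinates in terms of the lattice invariants**: with `g₂, g₃ = g_k(Λ_τ)`,
`h₂, h₃ = g_k(Λ_{Nτ})` and `D = g₂³ − 27g₃²`, the six coordinates are
`1728·g₂³/D, 46656·g₃²/D, 1728·g₂²h₂/D, 46656·g₃h₃/D, 1728·h₂³/D, 46656·h₃²/D` — rational multiples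
of weight-zero ratios of the invariants (the powers of `π` cancel). [folklore] -/
theorem eisCoord_eq (i : Fin 6) (τ : ℍ) :
    eisCoord N i τ =
      (match i with
        | 0 => 1728 * (ofUpperHalfPlane τ).g₂ ^ 3
        | 1 => 46656 * (ofUpperHalfPlane τ).g₃ ^ 2
        | 2 => 1728 * ((ofUpperHalfPlane τ).g₂ ^ 2 * (ofUpperHalfPlane (levelPoint N τ)).g₂)
        | 3 => 46656 * ((ofUpperHalfPlane τ).g₃ * (ofUpperHalfPlane (levelPoint N τ)).g₃)
        | 4 => 1728 * (ofUpperHalfPlane (levelPoint N τ)).g₂ ^ 3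
        | 5 => 46656 * (ofUpperHalfPlane (levelPoint N τ)).g₃ ^ 2) /
        ((ofUpperHalfPlane τ).g₂ ^ 3 - 27 * (ofUpperHalfPlane τ).g₃ ^ 2) := by
  have hπ : (π : ℂ) ≠ 0 := by exact_mod_cast Real.pi_ne_zero
  have hD := discr_div_ne_zero τ
  fin_cases i <;>
    simp only [eisCoord, eisMonomial_apply, E₄_eq_g₂, E₆_eq_g₃, scaleN_E₄_eq_g₂, scaleN_E₆_eq_g₃,
      discriminant_eq_discr] <;>
    field_simp <;> ring

end Forms

/-! ### Injectivity: the coordinates determine the point of `Y₀(N)` -/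

section Injectivity

variable {N : ℕ} [NeZero N]

/-- Clearing the common rational constant: `cx/D₁ = cy/D₂` gives `y = (D₂/D₁)x`. [folklore] -/
private theorem eq_mul_of_div_eq_div {c x y D₁ D₂ : ℂ} (hc : c ≠ 0) (hD₁ : D₁ ≠ 0) (hD₂ : D₂ ≠ 0)
    (h : c * x / D₁ = c * y / D₂) : y = D₂ / D₁ * x := by
  rw [div_eq_div_iff hD₁ hD₂] at h
  have h' : x * D₂ = y * D₁ := mul_left_cancel₀ hc (by linear_combination h)
  rw [div_mul_eq_mul_div, eq_div_iff hD₁]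
  linear_combination -h'

/-- **The Eisenstein coordinates separate the points of `Y₀(N)`**: if the six ratios
`m_i(τ)/Δ(τ)` agree at `τ₁` and `τ₂` then `τ₂ = γτ₁` for some `γ ∈ Γ₀(N)`.  The weight-`12` monomials
in the invariants of `(Λ_{τ₁}, Λ_{Nτ₁})` and `(Λ_{τ₂}, Λ_{Nτ₂})` are then proportional, hence the
quadruples of invariants differ by a common scaling (`exists_common_scaling`), the two pairs of
lattices by a common homothety (uniqueness of uniformisation), and `exists_gamma0_smul_eq_of_lattice_pair_eq`
applies (Diamond–Shurman Thm. 1.5.1). [cite: DiamondShurman2005, Thm. 1.5.1] -/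
theorem exists_gamma0_smul_eq_of_eisCoord_eq {τ₁ τ₂ : ℍ} (h : ∀ i, eisCoord N i τ₁ = eisCoord N i τ₂) :
    ∃ γ : Gamma0 N, (γ : SL(2, ℤ)) • τ₁ = τ₂ := by
  have hD₁ := discr_div_ne_zero τ₁
  have hD₂ := discr_div_ne_zero τ₂
  have h1728 : (1728 : ℂ) ≠ 0 := by norm_num
  have h46656 : (46656 : ℂ) ≠ 0 := by norm_num
  set lam := ((ofUpperHalfPlane τ₂).g₂ ^ 3 - 27 * (ofUpperHalfPlane τ₂).g₃ ^ 2) /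
    ((ofUpperHalfPlane τ₁).g₂ ^ 3 - 27 * (ofUpperHalfPlane τ₁).g₃ ^ 2) with hlam_def
  have hlam : lam ≠ 0 := div_ne_zero hD₂ hD₁
  have e := fun i ↦ (eisCoord_eq i τ₁).symm.trans ((h i).trans (eisCoord_eq i τ₂))
  have e1 := eq_mul_of_div_eq_div h1728 hD₁ hD₂ (e 0)
  have e2 := eq_mul_of_div_eq_div h46656 hD₁ hD₂ (e 1)
  have e3 := eq_mul_of_div_eq_div h1728 hD₁ hD₂ (e 2)
  have e4 := eq_mul_of_div_eq_div h46656 hD₁ hD₂ (e 3)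
  have e5 := eq_mul_of_div_eq_div h1728 hD₁ hD₂ (e 4)
  have e6 := eq_mul_of_div_eq_div h46656 hD₁ hD₂ (e 5)
  obtain ⟨ν, hν0, k1, k2, k3, k4⟩ := exists_common_scaling hD₁ hlam e1 e2 e3 e4 e5 e6
  have hc : ν⁻¹ ≠ 0 := inv_ne_zero hν0
  have hL : (ofUpperHalfPlane τ₂).lattice = ((ofUpperHalfPlane τ₁).mulLeft ν⁻¹ hc).lattice :=
    lattice_eq_mulLeft_of_g₂_g₃ hc (by rw [inv_pow, inv_inv]; exact k1)
      (by rw [inv_pow, inv_inv]; exact k2)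
  have hM : (ofUpperHalfPlane (levelPoint N τ₂)).lattice =
      ((ofUpperHalfPlane (levelPoint N τ₁)).mulLeft ν⁻¹ hc).lattice :=
    lattice_eq_mulLeft_of_g₂_g₃ hc (by rw [inv_pow, inv_inv]; exact k3)
      (by rw [inv_pow, inv_inv]; exact k4)
  exact exists_gamma0_smul_eq_of_lattice_pair_eq hc hL hM

/-- **Transport of the coordinates along `Aut(ℂ)`**: if `σ` carries the level-`N` structure of `τ`
to that of `τ'` (`LevelTransport N σ τ τ'`), then `σ(m_i(τ)/Δ(τ)) = m_i(τ')/Δ(τ')` — the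
coordinates are rational multiples of weight-zero ratios of the lattice invariants, on which `σ`
acts through the common factor `μ¹²`. [folklore] -/
theorem LevelTransport.apply_eisCoord {σ : ℂ ≃+* ℂ} {τ τ' : ℍ} (h : LevelTransport N σ τ τ')
    (i : Fin 6) : σ (eisCoord N i τ) = eisCoord N i τ' := by
  obtain ⟨μ, hμ, h₂, h₃, h₂', h₃'⟩ := h
  have hD := discr_div_ne_zero τ
  have hD' := discr_div_ne_zero τ'
  have hμ12 : μ ^ 12 ≠ 0 := pow_ne_zero _ hμ
  have hσD : σ ((ofUpperHalfPlane τ).g₂ ^ 3 - 27 * (ofUpperHalfPlane τ).g₃ ^ 2) =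
      μ ^ 12 * ((ofUpperHalfPlane τ').g₂ ^ 3 - 27 * (ofUpperHalfPlane τ').g₃ ^ 2) := by
    rw [map_sub, map_mul, map_pow, map_pow, h₂, h₃, map_ofNat]; ring
  fin_cases i <;>
    simp only [eisCoord_eq, map_div₀, map_mul, map_pow, map_ofNat, h₂, h₃, h₂', h₃', hσD] <;>
    field_simp

/-- The coordinates are `Γ₀(N)`-invariant (the case `σ = 1` of the transport, through
`levelTransport_refl` and `LevelTransport.smul_right`). [folklore] -/
theorem eisCoord_gamma0_smul (γ : Gamma0 N) (i : Fin 6) (τ : ℍ) :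
    eisCoord N i ((γ : SL(2, ℤ)) • τ) = eisCoord N i τ := by
  have h : LevelTransport N (RingEquiv.refl ℂ) τ ((γ : SL(2, ℤ)) • τ) :=
    (levelTransport_refl τ).smul_right γ
  exact (h.apply_eisCoord i).symm

/-- **The Eisenstein coordinates are a complete invariant of the point of `Y₀(N)`.**
[cite: DiamondShurman2005, Thm. 1.5.1] -/
theorem eisCoord_eq_iff {τ₁ τ₂ : ℍ} :
    (∀ i, eisCoord N i τ₁ = eisCoord N i τ₂) ↔ ∃ γ : Gamma0 N, (γ : SL(2, ℤ)) • τ₁ = τ₂ := by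
  refine ⟨exists_gamma0_smul_eq_of_eisCoord_eq, ?_⟩
  rintro ⟨γ, rfl⟩ i
  exact (eisCoord_gamma0_smul γ i τ₁).symm

end Injectivity

/-! ### Distinct points of `Y₀(N)` have distinct places of `K_N` -/

section Places

variable {N : ℕ} [NeZero N]

omit [NeZero N] in
/-- `ord_τ(F) = 0 ↔ F(τ) ≠ 0` for a nonzero form. [folklore] -/
theorem orderAt_eq_zero_iff {k : ℤ} {F : ModularForm (Gamma0 N) k} (hF : F ≠ 0) (τ : ℍ) :
    orderAt F τ = 0 ↔ F τ ≠ 0 := by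
  have h := orderAt_eq hF τ
  rw [← Nat.cast_inj (R := ℕ∞), h, Nat.cast_zero,
    (analyticAt_comp_ofComplex (ModularFormClass.holo F) τ).analyticOrderAt_eq_zero, Function.comp_apply,
    ofComplex_apply]

/-- The element `m_i/Δ − c ∈ K_N` is represented by the form `m_i − cΔ` over `Δ`. [folklore] -/
theorem eisCoordFn_sub_algebraMap_mul (i : Fin 6) (c : ℂ) :
    ((eisCoordFn N i - algebraMap ℂ (modularFunctionField N) c : modularFunctionField N) :
        LaurentSeries ℂ) * qExpansionL N (deltaN N) =
      qExpansionL N (eisMonomial N i - c • deltaN N) := by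
  rw [sub_eq_add_neg (eisMonomial N i), qExpansionL_add, qExpansionL_neg, qExpansionL_smul,
    ← HahnSeries.C_mul_eq_smul, ← sub_eq_add_neg, AddSubgroupClass.coe_sub, sub_mul, eisCoordFn,
    mkFn_mul, ← algebraMap_laurentSeries_apply]
  rfl

/-- `(m_i − cΔ)(τ) = Δ(τ)(eisCoord N i τ − c)`. [folklore] -/
theorem eisMonomial_sub_smul_apply (i : Fin 6) (c : ℂ) (τ : ℍ) :
    (eisMonomial N i - c • deltaN N) τ = ModularForm.discriminant τ * (eisCoord N i τ - c) := by
  have hΔ := ModularForm.discriminant_ne_zero τ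
  rw [eisCoord]
  field_simp
  simp [deltaN, coe_ofLevelOne, delta, sub_eq_add_neg]
  ring

/-- **Distinct points of `Y₀(N)` give distinct places**: if some Eisenstein coordinate differs at `τ₁`
and `τ₂`, the function `x = m_i/Δ − m_i(τ₂)/Δ(τ₂) ∈ K_N` has `ord_{τ₂} x > 0 = ord_{τ₁} x`, so
`x⁻¹ ∈ O_{τ₁} ∖ O_{τ₂}` and `P_{τ₁} ≠ P_{τ₂}`. [folklore] -/
theorem pointPlace_ne_of_eisCoord_ne {τ₁ τ₂ : ℍ} {i : Fin 6}
    (h : eisCoord N i τ₁ ≠ eisCoord N i τ₂) : pointPlace (N := N) τ₁ ≠ pointPlace (N := N) τ₂ := by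
  set c := eisCoord N i τ₂ with hc_def
  set x : modularFunctionField N := eisCoordFn N i - algebraMap ℂ (modularFunctionField N) c
    with hx_def
  set F : ModularForm (Gamma0 N) 12 := eisMonomial N i - c • deltaN N with hF_def
  have hF1 : F τ₁ ≠ 0 := by
    rw [hF_def, eisMonomial_sub_smul_apply]
    exact mul_ne_zero (ModularForm.discriminant_ne_zero τ₁) (sub_ne_zero.mpr h)
  have hF2 : F τ₂ = 0 := by
    rw [hF_def, eisMonomial_sub_smul_apply, hc_def, sub_self, mul_zero]
  have hF0 : F ≠ 0 := fun h0 ↦ hF1 (by rw [h0]; rfl)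
  have hrepr : (x : LaurentSeries ℂ) * qExpansionL N (deltaN N) = qExpansionL N F :=
    eisCoordFn_sub_algebraMap_mul i c
  have hx : x ≠ 0 := by
    intro h0
    rw [h0, ZeroMemClass.coe_zero, zero_mul, eq_comm, qExpansionL_eq_zero_iff] at hrepr
    exact hF0 hrepr
  have hord : ∀ τ, ordAt τ x = orderAt F τ := fun τ ↦ by
    rw [ordAt_eq_of_repr hx ofLevelOne_delta_ne_zero hrepr, orderAt_delta]; simp
  have hord1 : ordAt τ₁ x = 0 := by rw [hord, (orderAt_eq_zero_iff hF0 τ₁).mpr hF1]; rfl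
  have hord2 : 0 < ordAt τ₂ x := by
    rw [hord]
    exact_mod_cast Nat.pos_of_ne_zero fun h0 ↦ (orderAt_eq_zero_iff hF0 τ₂).mp h0 hF2
  -- orders of `x⁻¹`
  have hinv : ∀ τ, ordAtN τ x⁻¹ + ordAtN τ x = 0 := fun τ ↦ by
    rw [← ordAtN_mul τ (inv_ne_zero hx) hx, inv_mul_cancel₀ hx,
      show (1 : modularFunctionField N) = algebraMap ℂ (modularFunctionField N) 1 from
        (map_one _).symm, ordAtN_algebraMap τ one_ne_zero]
  have hN1 : ordAtN τ₁ x = 0 := by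
    have := ordAtN_mul_ellipticPeriod τ₁ x
    rw [hord1] at this
    rcases mul_eq_zero.mp this with h0 | h0
    · exact h0
    · exact absurd h0 (ellipticPeriod_cast_pos τ₁).ne'
  have hN2 : 0 < ordAtN τ₂ x := by
    have := ordAtN_mul_ellipticPeriod τ₂ x
    rw [← this] at hord2
    exact pos_of_mul_pos_left hord2 (ellipticPeriod_cast_pos τ₂).le
  intro heq
  have h1 : x⁻¹ ∈ (pointPlace (N := N) τ₁).toValuationSubring := by
    rw [pointPlace_toValuationSubring, mem_valuationSubring_pointValuation_iff]
    right; linarith [hinv τ₁]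
  have h2 : x⁻¹ ∉ (pointPlace (N := N) τ₂).toValuationSubring := by
    rw [pointPlace_toValuationSubring, mem_valuationSubring_pointValuation_iff]
    rintro (h0 | h0)
    · exact inv_ne_zero hx h0
    · linarith [hinv τ₂]
  rw [heq] at h1
  exact h2 h1

/-- **Places of `K_N` at `Γ₀(N)`-inequivalent points are distinct** (with the tree's
`pointPlace_smul_of_mem`: `τ ↦ P_τ` induces an injection of `Y₀(N)` into the places of `K_N/ℂ`;
Diamond–Shurman §7.5). [cite: DiamondShurman2005, §7.5] -/
theorem pointPlace_eq_iff {τ₁ τ₂ : ℍ} :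
    pointPlace (N := N) τ₁ = pointPlace (N := N) τ₂ ↔ ∃ γ : Gamma0 N, (γ : SL(2, ℤ)) • τ₁ = τ₂ := by
  constructor
  · intro heq
    by_contra hne
    rw [← eisCoord_eq_iff, not_forall] at hne
    obtain ⟨i, hi⟩ := hne
    exact pointPlace_ne_of_eisCoord_ne hi heq
  · rintro ⟨γ, rfl⟩
    exact (pointPlace_smul_of_mem γ.2 τ₁).symm

end Places

end Literature.NumberTheory.EllipticCurves

end
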